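import Summits.PneNP.PneNP.Theorems.GapMCSPWindowCellZeroCount
import Literature.Computability.MetaComplexity.GapMCSPLightConeLowerBound

/-!
# Gap-MCSP window cell `q = 0`: the size–acceptance TRADE-OFF LAW for `B₂`-circuits and `Gap-MCSP ∉ SIZEae(N)`

Part of the tree landing of HOME/decomp-pnenp-lens-1/TradeOffLaw.lean (sha256 880b490f…, lens-1 g13 of the decomp-pnenp root-decomposition cell; critic NODE-VERDICT 2026-08-30T13:09:32Z CLEARED, landing endorsed (6)(a)):
a SIZE–ACCEPTANCE TRADE-OFF for every `B₂`-circuit on `N` inputs that accepts `0^N` and every point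
indicator `e_p` — `N ≤ 9·L·(L + G + 3 − N)`, `L = ⌊log₂ acc⌋`, `G` = number of gates — and its payout:
the Oliveira–Pich–Santhanam gap problem `Gap-MCSP[2^{βn}/(cn), 2^{βn}]` (census R3) is not separated by
`B₂`-circuit families of eventually `≤ N` gates (`0 < β < 1/3`, every `c ≥ 1`), i.e. the `q = 0` cell of
the window dial of route `route-PneNP-RootDecompMagnificationPayout` (item stmt-PneNP-33309 `WindowCellZero`,
BC5 rung for the attacked item stmt-PneNP-32096). Modules, in dependency order: `…Formulas` (rooted
`B₂`-formulas and additive valuations) → `…Counting` (uniform counting, silent/flipping variables, numeric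
helpers) → `…FlipLaw` (the exact acceptance law for read-once formulas) → `…Unfolding` (rooted unfolding of a
gate list, consistency, references) → `…Potential` (variables/nodes of unfoldings, the root potential: no
duplication across root formulas) → `…Relevance` (relevant roots, link, locality) → `…Product` (boxes, the two
exponent bounds, pigeonhole, the final arithmetic) → `…Count` (`t + 2·nocc ≤ 2G + 3`) → `GapMCSPWindowCellZero`
(the law proved, the payout in tree vocabulary). Proof-internal machinery: nothing here bears on P vs NP
beyond the S-free lower bound it proves; all statements are [folklore]-tagged kernel lemmas of the lens.

THIS FILE (lens §8–§10): the gap-MCSP instantiation helpers (tabulation, YES witnesses: constants and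
point functions have small `B₂`-circuits; SPARSITY of the complement of NO by the tree's circuit count
`card_filter_circuitSizeOver_le` [cite: AroraBarak2009, Thm. 6.21]; numerics `n + 1 ≤ ⌊2^{βn}/(cn)⌋`
eventually); the TRADE-OFF LAW `tradeOffLaw_holds` (`c = 9`; stated as a theorem, no `def : Prop`); the payout
`gapMCSP_R3_not_mem_SIZEae_id`: `Gap-MCSP[2^{βn}/(cn), 2^{βn}] ∉ promiseLift (SIZEae fun N => N)` for all
`c ≥ 1`, `0 < β < 1/3` — the FIRST a.e. `B₂` lower bound of exactly `N` gates for this problem in the tree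
(floor `N − ⌈N^{β′}⌉`: `gapMCSP_not_mem_SIZEae_sublinear`; consistent with Chen–Jin–Williams 2020 p. 4: no
super-linear `B₂` bound for an MCSP variant is known). Gap-MCSP / `SIZEae` / `promiseLift` / `yesBound` /
`noBound` are the tree's [cite: OliveiraPichSanthanam2021, §1.2 and Thm. 1.4 (parameters)]. NOT here: the
route-level window vocabulary (`CircuitWindowCell q`, shadows/lifts) — the item of N40 is closed BY NAME in
`RootDecompMagnificationPayoutWindowCellZero.lean`.
-/

noncomputable section

set_option linter.dupNamespace false -- `Summit.PneNP.PneNP.…`: summit = sub-problem name (D-0017 single-conjunct layout)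

namespace Summit.PneNP.PneNP.Theorems.GapMCSPWindowCellZero

open Literature.Computability.Complexity
open Literature.Computability.MetaComplexity
open Filter

/-! ## §8 The gap-MCSP instantiation helpers (lineage g12 §6, verbatim) and the `q = 0` cell -/

section Instantiation

open Finset

variable {n : ℕ}

/-- Tabulation: the `n`-variable Boolean function whose truth table is the string `u`. [folklore] -/
def tbl (u : Fin (2 ^ n) → Bool) : (Fin n → Bool) → Bool := fun v => u (boolFunEquivFin n v)

/-- The truth table of the tabulated function is the string itself. [folklore] -/
theorem truthTable_tbl (u : Fin (2 ^ n) → Bool) : truthTable (tbl u) = List.ofFn u := by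
  simp [truthTable, tbl]

/-- A string is a YES instance of `Gap-MCSP[a,b]` iff its function has `B₂`-circuits of size `≤ a n`. [folklore] -/
theorem ofFn_mem_gapMCSP_yes_iff (a b : ℕ → ℕ) (u : Fin (2 ^ n) → Bool) :
    List.ofFn u ∈ (gapMCSP a b).yes ↔ circuitSizeOver B2 (tbl u) ≤ a n := by
  rw [gapMCSP_yes, ← truthTable_tbl, truthTable_mem_MCSPSize_iff]

/-- A string is outside the NO part of `Gap-MCSP[a,b]` iff its function has `B₂`-circuits of size `≤ b n`. [folklore] -/
theorem ofFn_not_mem_gapMCSP_no_iff (a b : ℕ → ℕ) (u : Fin (2 ^ n) → Bool) :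
    List.ofFn u ∉ (gapMCSP a b).no ↔ circuitSizeOver B2 (tbl u) ≤ b n := by
  rw [← truthTable_tbl, truthTable_mem_gapMCSP_no_iff, not_lt]

/-- YES witness 1: constants have `B₂`-circuits of size `≤ 1`. [folklore] -/
theorem circuitSizeOver_const_le (n : ℕ) (b : Bool) :
    circuitSizeOver B2 (fun _ : Fin n → Bool => b) ≤ 1 := by
  obtain ⟨C, hB, hs, hC⟩ := (cktSize_const (Fin n) b).toCircuit
  exact (circuitSizeOver_le_of_computes C hB (fun x => hC x)).trans hs

/-- The prefix-agreement chain `[v₀ = α₀] ∧ … ∧ [v_{k-1} = α_{k-1}]`. [folklore] -/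
def chainFn (α : Fin n → Bool) (k : ℕ) : (Fin n → Bool) → Unit → Bool :=
  fun v _ => decide (∀ i : Fin n, (i : ℕ) < k → v i = α i)

/-- The chain has a `B₂`-circuit of size `k + 1` (one constant gate, then one binary gate
`a ∧ [b = αᵢ]` per variable). [folklore] -/
theorem cktSize_chainFn (α : Fin n → Bool) : ∀ k : ℕ, CktSize B2 (chainFn α k) (k + 1)
  | 0 => (cktSize_const (Fin n) true).congr fun v _ => by simp [chainFn]
  | k + 1 => by
    by_cases hk : k < n
    · let i₀ : Fin n := ⟨k, hk⟩
      let op : GateFn := ⟨2, fun a => a 0 && (a 1 == α i₀)⟩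
      have hop : op ∈ B2 := by simp [B2, op]
      have h := ((cktSize_chainFn α k).pair (CktSize.proj B2 (fun _ : Unit => i₀))).comp
        (CktSize.gate op hop ![Sum.inl (), Sum.inr ()])
      refine (h.of_le (by omega)).congr fun v u => ?_
      simp only [chainFn, op, Matrix.cons_val_zero, Matrix.cons_val_one, Sum.elim_inl,
        Sum.elim_inr]
      rw [Bool.eq_iff_iff]
      simp only [Bool.and_eq_true, decide_eq_true_eq, beq_iff_eq]
      constructor
      · rintro ⟨h1, h2⟩ i hi
        rcases Nat.lt_or_ge (i : ℕ) k with hik | hik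
        · exact h1 i hik
        · have : i = i₀ := Fin.ext (by simp [i₀]; omega)
          rw [this]; exact h2
      · intro h
        exact ⟨fun i hi => h i (by omega), h i₀ (by simp [i₀])⟩
    · refine ((cktSize_chainFn α k).of_le (by omega)).congr fun v u => ?_
      simp only [chainFn]
      rw [Bool.eq_iff_iff]
      simp only [decide_eq_true_eq]
      constructor
      · intro h i _; exact h i (by omega)
      · intro h i _; exact h i (by omega)

/-- The point function `[v = α]`. [folklore] -/
def ptFn (α : Fin n → Bool) : (Fin n → Bool) → Bool := fun v => decide (v = α)

/-- YES witness 2: point functions have `B₂`-circuits of size `≤ n + 1`. [folklore] -/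
theorem circuitSizeOver_ptFn_le (α : Fin n → Bool) : circuitSizeOver B2 (ptFn α) ≤ n + 1 := by
  have h : CktSize B2 (fun v (_ : Unit) => ptFn α v) (n + 1) :=
    (cktSize_chainFn α n).congr fun v _ => by
      simp only [chainFn, ptFn]
      rw [Bool.eq_iff_iff]
      simp only [decide_eq_true_eq, funext_iff]
      exact ⟨fun h i => h i i.isLt, fun h i _ => h i⟩
  obtain ⟨C, hB, hs, hC⟩ := h.toCircuit
  exact (circuitSizeOver_le_of_computes C hB (fun x => hC x)).trans hs

/-- The table of the point string `e_p` is a point function. [folklore] -/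
theorem tbl_indicator (p : Fin (2 ^ n)) :
    tbl (fun i : Fin (2 ^ n) => decide (i = p)) = ptFn ((boolFunEquivFin n).symm p) := by
  funext v
  simp [tbl, ptFn, Equiv.apply_eq_iff_eq_symm_apply]

/-- **SPARSITY of the complement of NO** (tree circuit count, Arora–Barak Thm. 6.21): at most
`(b+1)(16(n+b+1)²)^b (n+b+1)` strings of length `2ⁿ` lie in any set avoiding the NO part of
`Gap-MCSP[a,b]`.
[cite: AroraBarak2009, Thm. 6.21 (proof: counting circuits)] -/
theorem card_nonNo_le (a b : ℕ → ℕ) (n : ℕ) (s : Finset (Fin (2 ^ n) → Bool))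
    (hs : ∀ u ∈ s, List.ofFn u ∉ (gapMCSP a b).no) :
    s.card ≤ (b n + 1) * (16 * (n + b n + 1) ^ 2) ^ b n * (n + b n + 1) := by
  classical
  have htbl_inj : Function.Injective (tbl (n := n)) := by
    intro x x' h
    funext i
    have := congrFun h ((boolFunEquivFin n).symm i)
    simpa [tbl] using this
  calc s.card
      ≤ #{f : (Fin n → Bool) → Bool | circuitSizeOver B2 f ≤ b n} := by
        refine card_le_card_of_injOn tbl (fun x hx => ?_) htbl_inj.injOn
        simp only [coe_filter, Set.mem_setOf_eq, mem_univ, true_and]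
        exact (ofFn_not_mem_gapMCSP_no_iff a b x).1 (hs x hx)
    _ ≤ (b n + 1) * (16 * (n + b n + 1) ^ 2) ^ b n * (n + b n + 1) :=
        card_filter_circuitSizeOver_le n (b n)

/-- NUMERICS: `n + 1 ≤ ⌊2^{βn}/(cn)⌋` eventually. [folklore] -/
theorem eventually_succ_le_yesBound (c : ℕ) (hc : 1 ≤ c) {β : ℝ} (hβ : 0 < β) :
    ∀ᶠ n : ℕ in atTop, n + 1 ≤ OliveiraPichSanthanam2019.yesBound c β n := by
  have hr : 1 < (2 : ℝ) ^ β := Real.one_lt_rpow (by norm_num) hβ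
  have ht := tendsto_pow_const_div_const_pow_of_one_lt 3 hr
  have hev : ∀ᶠ n : ℕ in atTop, (n : ℝ) ^ 3 / ((2 : ℝ) ^ β) ^ n < 1 :=
    (tendsto_order.1 ht).2 1 zero_lt_one
  filter_upwards [hev, eventually_ge_atTop (2 * c)] with n hn hnc
  have hn1 : 1 ≤ n := by omega
  have hpow : ((2 : ℝ) ^ β) ^ n = (2 : ℝ) ^ (β * n) := by
    rw [← Real.rpow_natCast, ← Real.rpow_mul (by norm_num)]
  have hden : (0 : ℝ) < ((2 : ℝ) ^ β) ^ n := by positivity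
  have h3 : (n : ℝ) ^ 3 ≤ (2 : ℝ) ^ (β * n) := by
    rw [← hpow]
    have := (div_lt_one hden).1 hn
    exact this.le
  unfold OliveiraPichSanthanam2019.yesBound
  apply Nat.le_floor
  have hcn : (0 : ℝ) < (c : ℝ) * n := by
    have : (0 : ℝ) < c := by exact_mod_cast hc
    have : (0 : ℝ) < n := by exact_mod_cast hn1
    positivity
  rw [le_div_iff₀ hcn]
  calc ((n + 1 : ℕ) : ℝ) * ((c : ℝ) * n) ≤ (n : ℝ) ^ 3 := by
        have h2c : (2 * c : ℝ) ≤ n := by exact_mod_cast hnc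
        have hn0 : (1 : ℝ) ≤ n := by exact_mod_cast hn1
        have hc0 : (0 : ℝ) ≤ c := by positivity
        push_cast
        nlinarith [mul_nonneg hc0 (by linarith : (0 : ℝ) ≤ n), mul_nonneg (by linarith : (0:ℝ) ≤ n) (by linarith : (0:ℝ) ≤ n)]
    _ ≤ (2 : ℝ) ^ (β * n) := h3


end Instantiation

/-! ## The trade-off law, its proof, and the payout in tree vocabulary -/

section TradeOff

open Finset
open Literature.Computability.Complexity.GateList

/-- **THE SIZE–ACCEPTANCE TRADE-OFF LAW** (lens-1 g12 §11 statement with the constant made explicit,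
there conjectural; PROVED here with `c = 9`): for every `B₂`-circuit `C` on `N` inputs accepting `0^N` and
every point indicator `e_p`, `N ≤ 9 · L · (L + G + 3 − N)` with `L = ⌊log₂ acc(C)⌋`, `G = C.size`;
equivalently `G ≥ N + N/(9L) − L − 3`. PROOF: §§III–VIII assembled — for a `B₂` gate list with output
gate `m₀` accepting `0^N` and all `e_p`, PIGEON gives `M` with `nocc ≤ (t+1)·M` and
`2^{2N+M} ≤ 2·2^{2nocc}·A²`, the COUNT gives `t + 2·nocc ≤ 2G + 3`, `nocc ≤ N`, the ball gives `N + 1 ≤ A`,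
and `arith` concludes; an input-wire output cannot accept `0^N`. Hypothesis-free. [folklore] -/
theorem tradeOffLaw_holds : ∀ (N : ℕ) (C : Circuit (Fin N)), C.IsOver B2 →
    C.eval (fun _ => false) = true → (∀ p : Fin N, C.eval (fun i => decide (i = p)) = true) →
      N ≤ 9 * Nat.log 2 (acc C.eval true) * (Nat.log 2 (acc C.eval true) + C.size + 3 - N) := by
  classical
  intro N C hB h0 h1
  have har : ∀ g ∈ C.gates, g.arity ≤ 2 := fun g hg => by
    have := hB g hg
    simpa [B2, Gate.fn] using this
  have hwf : BF.WFL C.gates := fun j g hg a m ha => by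
    obtain ⟨hj, rfl⟩ := List.getElem?_eq_some_iff.1 hg
    exact C.wf j hj a m ha
  rcases C with ⟨gs, out, wf, hout⟩
  cases out with
  | inl i =>
    -- an input wire as output rejects `0^N`
    simp [Circuit.eval] at h0
  | inr m₀ =>
    have hm₀ : m₀ < gs.length := hout m₀ rfl
    have hev : (Circuit.eval ⟨gs, .inr m₀, wf, hout⟩ : (Fin N → Bool) → Bool) = BF.outv gs m₀ := by
      funext x; rfl
    simp only [hev, Circuit.size] at h0 h1 ⊢
    change BF.outv gs m₀ x0 = true at h0
    change ∀ p : Fin N, BF.outv gs m₀ (e p) = true at h1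
    obtain ⟨M, hM, hA1⟩ := BF.pigeon hwf har hm₀ h0 h1
    exact BF.arith N gs.length _ _ _ M (BF.nocc_le_N hwf har hm₀) hA1 hM (BF.count hwf har hm₀)
      (BF.succ_le_acc h0 h1)

/-- NUMERICS: `c·⌈N^{1/3}⌉·(⌈N^{1/3}⌉ + 3) < N` eventually. [folklore] -/
theorem eventually_tradeOff_numerics (c : ℕ) :
    ∀ᶠ N : ℕ in atTop, c * ⌈(N : ℝ) ^ (1 / 3 : ℝ)⌉₊ * (⌈(N : ℝ) ^ (1 / 3 : ℝ)⌉₊ + 3) < N := by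
  have hpos : (0 : ℝ) < 1 / 3 := by norm_num
  have hev : ∀ᶠ x : ℝ in atTop, (10 * c + 1 : ℝ) ≤ x ^ (1 / 3 : ℝ) :=
    (tendsto_rpow_atTop hpos).eventually_ge_atTop _
  filter_upwards [tendsto_natCast_atTop_atTop.eventually hev, eventually_ge_atTop 1] with N hN hN1
  set t : ℝ := (N : ℝ) ^ (1 / 3 : ℝ) with ht
  have hN0 : (0 : ℝ) ≤ (N : ℝ) := Nat.cast_nonneg N
  have ht0 : 0 ≤ t := Real.rpow_nonneg hN0 _
  have ht3 : t ^ (3 : ℕ) = N := by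
    rw [ht, ← Real.rpow_natCast, ← Real.rpow_mul hN0]; norm_num
  have hK : (⌈t⌉₊ : ℝ) < t + 1 := Nat.ceil_lt_add_one ht0
  have hc0 : (0 : ℝ) ≤ c := Nat.cast_nonneg c
  have htc : (10 * c : ℝ) < t := by linarith
  have ht1 : 1 ≤ t := by linarith
  have hK2 : (⌈t⌉₊ : ℝ) ≤ 2 * t := by linarith
  have hK5 : (⌈t⌉₊ : ℝ) + 3 ≤ 5 * t := by linarith
  have key : (c : ℝ) * ⌈t⌉₊ * (⌈t⌉₊ + 3) < N := by
    calc (c : ℝ) * ⌈t⌉₊ * (⌈t⌉₊ + 3) ≤ c * (2 * t) * (5 * t) :=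
          mul_le_mul (mul_le_mul_of_nonneg_left hK2 hc0) hK5 (by positivity)
            (mul_nonneg hc0 (by linarith))
      _ = 10 * c * t ^ 2 := by ring
      _ < t * t ^ 2 := mul_lt_mul_of_pos_right htc (pow_pos (by linarith) 2)
      _ = t ^ (3 : ℕ) := by ring
      _ = N := ht3
  exact_mod_cast key

/-- **PAYOUT, instance-wise**: a trade-off law with ANY constant `c` proves the `q = 0` window lower bound — R3's
`Gap-MCSP[2^{βn}/(cn), 2^{βn}]` is not separated by `B₂`-circuit families of eventually `≤ N` gates — for
all `c₀ ≥ 1` and `0 < β < 1/3`. At `N = 2ⁿ` a separator with `G ≤ N` accepts `0^N` and all `e_p` (YES: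
circuits of size `≤ n + 1 ≤ 2^{βn}/(c₀n)` eventually) and `< 2^{⌈N^{1/3}⌉}` strings (all outside NO, circuit
counting), so `L ≤ N^{1/3}` and `N ≤ c·L·(L+3)` fails for `N` large. `S`-free. [folklore] -/
theorem gapMCSP_not_mem_SIZEae_id_of_tradeOff (c : ℕ)
    (hc : ∀ (N : ℕ) (C : Circuit (Fin N)), C.IsOver B2 → C.eval (fun _ => false) = true →
      (∀ p : Fin N, C.eval (fun i => decide (i = p)) = true) →
        N ≤ c * Nat.log 2 (acc C.eval true) * (Nat.log 2 (acc C.eval true) + C.size + 3 - N))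
    (c₀ : ℕ) (hc₀ : 1 ≤ c₀) (β : ℝ) (hβ : 0 < β) (hβ3 : β < 1 / 3) :
    gapMCSP (OliveiraPichSanthanam2019.yesBound c₀ β) (OliveiraPichSanthanam2019.noBound β) ∉
      promiseLift (SIZEae fun N => N) := by
  classical
  have hβ'1 : (1 / 3 : ℝ) < 1 := by norm_num
  rintro ⟨L, ⟨C, ⟨n₀, hn₀⟩, hCL⟩, hy, hn⟩
  obtain ⟨n, ⟨⟨hcount, hyb⟩, hnum⟩, hn₁⟩ :=
    ((((eventually_circuitCount_noBound_lt hβ.le hβ3 hβ'1).and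
      (eventually_succ_le_yesBound c₀ hc₀ hβ)).and
      ((tendsto_pow_atTop_atTop_of_one_lt (one_lt_two : (1 : ℕ) < 2)).eventually
        (eventually_tradeOff_numerics c))).and (eventually_ge_atTop n₀)).exists
  have hNn₀ : n₀ ≤ 2 ^ n := hn₁.trans Nat.lt_two_pow_self.le
  obtain ⟨hB2, hsize⟩ := hn₀ (2 ^ n) hNn₀
  replace hsize : (C (2 ^ n)).size ≤ 2 ^ n := hsize
  set a := OliveiraPichSanthanam2019.yesBound c₀ β with ha
  set b := OliveiraPichSanthanam2019.noBound β with hb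
  set K := ⌈((2 ^ n : ℕ) : ℝ) ^ (1 / 3 : ℝ)⌉₊ with hK
  have hfL : ∀ u : Fin (2 ^ n) → Bool, (C (2 ^ n)).eval u = true ↔ List.ofFn u ∈ L := fun u => by
    rw [hCL.eval_eq u]
    exact (Set.mem_iff_boolIndicator _ _).symm
  have h0Y : List.ofFn (fun _ : Fin (2 ^ n) => false) ∈ (gapMCSP a b).yes := by
    rw [ofFn_mem_gapMCSP_yes_iff]
    exact (circuitSizeOver_const_le n false).trans (by omega)
  have hptY : ∀ p : Fin (2 ^ n), List.ofFn (fun i : Fin (2 ^ n) => decide (i = p)) ∈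
      (gapMCSP a b).yes := by
    intro p
    rw [ofFn_mem_gapMCSP_yes_iff, tbl_indicator]
    exact (circuitSizeOver_ptFn_le _).trans hyb
  have h0 : (C (2 ^ n)).eval (fun _ => false) = true := (hfL _).2 (hy h0Y)
  have hpt : ∀ p : Fin (2 ^ n), (C (2 ^ n)).eval (fun i => decide (i = p)) = true :=
    fun p => (hfL _).2 (hy (hptY p))
  set M := (b n + 1) * (16 * (n + b n + 1) ^ 2) ^ b n * (n + b n + 1) with hM
  have hacc : acc (C (2 ^ n)).eval true ≤ M := by
    refine card_nonNo_le a b n _ fun u hu => ?_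
    have huL : List.ofFn u ∈ L := (hfL u).1 (Finset.mem_filter.1 hu).2
    exact fun hno => hn hno huL
  have hX : 2 ^ n - (2 ^ n - K) - 1 ≤ K := by omega
  have hM2 : M < 2 ^ K := lt_of_lt_of_le hcount (Nat.pow_le_pow_right (by norm_num) hX)
  have hacc0 : acc (C (2 ^ n)).eval true ≠ 0 := by
    refine Finset.card_ne_zero.2 ⟨fun _ => false, ?_⟩
    exact Finset.mem_filter.2 ⟨Finset.mem_univ _, h0⟩
  have hL : Nat.log 2 (acc (C (2 ^ n)).eval true) < K :=
    Nat.log_lt_of_lt_pow hacc0 (hacc.trans_lt hM2)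
  have key := hc (2 ^ n) (C (2 ^ n)) hB2 h0 hpt
  set Lg := Nat.log 2 (acc (C (2 ^ n)).eval true) with hLg
  have h1 : Lg + (C (2 ^ n)).size + 3 - 2 ^ n ≤ K + 3 := by omega
  have h2 : c * Lg * (Lg + (C (2 ^ n)).size + 3 - 2 ^ n) ≤ c * K * (K + 3) :=
    Nat.mul_le_mul (Nat.mul_le_mul_left c hL.le) h1
  omega

/-- **THE `q = 0` WINDOW CELL, PROVED** (hypothesis-free, tree vocabulary only): for all `c ≥ 1` and
`0 < β < 1/3`, `Gap-MCSP[yesBound c β, noBound β] ∉ promiseLift (SIZEae fun N => N)` — R3's gap-MCSP has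
no `B₂`-circuit families of eventually `≤ N` gates. This is the S-free content of item stmt-PneNP-33309
`RootDecompMagnificationPayout.WindowCellZero` (β₀ = 1/3) and a BC5 rung strictly above the tree floor
`gapMCSP_not_mem_SIZEae_sublinear` (`N − ⌈N^{β′}⌉`) for the attacked item stmt-PneNP-32096 (`N·log N + 1`).
[folklore] -/
theorem gapMCSP_R3_not_mem_SIZEae_id (c : ℕ) (hc : 1 ≤ c) (β : ℝ) (hβ : 0 < β) (hβ3 : β < 1 / 3) :
    gapMCSP (OliveiraPichSanthanam2019.yesBound c β) (OliveiraPichSanthanam2019.noBound β) ∉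
      promiseLift (SIZEae fun N => N) :=
  gapMCSP_not_mem_SIZEae_id_of_tradeOff 9 tradeOffLaw_holds c hc β hβ hβ3

end TradeOff


end Summit.PneNP.PneNP.Theorems.GapMCSPWindowCellZero
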